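import Literature.Dynamics.Tilings.WangTilesReindex
import HarnessLib

/-!
# Tilings of cyclic bands `ℤ/n × {0, …, m}` by a Wang tile set

Topic `Literature/Dynamics/Tilings`. A valid tiling of the `n × n` torus by a tile set `T`
restricts, on any `m + 1 ≤ n` consecutive rows, to a tiling of the CYCLIC BAND of height `m + 1`:
columns are taken modulo `n` (horizontal matching everywhere, wrap-around included), rows
`0, …, m` match vertically, and nothing is required above row `0` or below row `m`. Band
tilings are the objects through which torus tautologies of "rigid" tile sets are refuted
(`TorusCNFBandRefutation.lean`: if some band of logarithmic height admits no tiling, the torus CNF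
has short bounded-depth Frege refutations; `KariBand.lean`: the Kari–Culik multiplication tile
set admits no band tiling of height `> log₂ 3n`).

* `WangTileSet.IsBandTiling T n m g` — `g : ℤ → ℕ → ι` (column, row; rows increase southward as
  in `IsPlaneTiling` / `IsTorusTiling`) is `n`-periodic in the column, matches horizontally on
  rows `≤ m` and vertically between rows `r < m` and `r + 1`;
* transfer along re-indexings of the tiles and injective recolourings
  (`IsBandTiling.of_reindex`, `IsBandTiling.of_map`), as for plane and torus tilings in
  `WangTilesReindex.lean`.

[folklore] (the notion is the standard "periodic strip"; cf. E. Jeandel, P. Vanier, LNM 2273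
(2020), §5.3, proof of Lemma 5, where a horizontal period is all that is used).
-/

namespace Literature.Dynamics.Tilings

namespace WangTileSet

universe u v w

variable {ι : Type u} {κ : Type w} {C : Type v}

/-- **Band tilings.** `g : ℤ → ℕ → ι` (column `c`, row `r`, rows increasing southward) tiles the
cyclic band `ℤ/n × {0, …, m}` by `T`: it is `n`-periodic in the column, horizontally matching on
the rows `0, …, m` (east of `(c, r)` against west of `(c + 1, r)`), and vertically matching
between consecutive rows (south of `(c, r)` against north of `(c, r + 1)`, `r < m`). [folklore] -/
def IsBandTiling (T : WangTileSet ι C) (n m : ℕ) (g : ℤ → ℕ → ι) : Prop :=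
  (∀ c : ℤ, ∀ r : ℕ, g (c + n) r = g c r) ∧
    (∀ c : ℤ, ∀ r ≤ m, T.east (g c r) = T.west (g (c + 1) r)) ∧
    ∀ c : ℤ, ∀ r < m, T.south (g c r) = T.north (g c (r + 1))

/-- Band tilings of a re-indexed tile set are band tilings (compose with the re-indexing).
[folklore] -/
theorem IsBandTiling.of_reindex {T : WangTileSet ι C} {e : κ → ι} {n m : ℕ} {g : ℤ → ℕ → κ}
    (h : (T.reindex e).IsBandTiling n m g) : T.IsBandTiling n m fun c r => e (g c r) :=
  ⟨fun c r => by show e (g (c + n) r) = e (g c r); rw [h.1 c r],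
    fun c r hr => h.2.1 c r hr, fun c r hr => h.2.2 c r hr⟩

/-- Band tilings of an injectively recoloured tile set are band tilings. [folklore] -/
theorem IsBandTiling.of_map {C' : Type*} {T : WangTileSet ι C} {f : C → C'}
    (hf : Function.Injective f) {n m : ℕ} {g : ℤ → ℕ → ι} (h : (T.map f).IsBandTiling n m g) :
    T.IsBandTiling n m g :=
  ⟨h.1, fun c r hr => hf (h.2.1 c r hr), fun c r hr => hf (h.2.2 c r hr)⟩

/-- A band tiling stays a band tiling on fewer rows. [folklore] -/
theorem IsBandTiling.mono {T : WangTileSet ι C} {n m m' : ℕ} {g : ℤ → ℕ → ι}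
    (h : T.IsBandTiling n m g) (hm : m' ≤ m) : T.IsBandTiling n m' g :=
  ⟨h.1, fun c r hr => h.2.1 c r (hr.trans hm), fun c r hr => h.2.2 c r (lt_of_lt_of_le hr hm)⟩

/-- Periodicity by any multiple of `n`. [folklore] -/
theorem IsBandTiling.periodic {T : WangTileSet ι C} {n m : ℕ} {g : ℤ → ℕ → ι}
    (h : T.IsBandTiling n m g) (c : ℤ) (r : ℕ) (k : ℕ) : g (c + k * n) r = g c r := by
  induction k with
  | zero => simp
  | succ k ih =>
    have e : c + ((k + 1 : ℕ) : ℤ) * n = (c + k * n) + n := by push_cast; ring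
    rw [e, h.1, ih]

/-- The column of the torus `(ℤ/n)²` under an integer column index. [folklore] -/
def colFin {n : ℕ} (hn : 0 < n) (c : ℤ) : Fin n :=
  ⟨(c % n).toNat, by
    have h0 : 0 ≤ c % n := Int.emod_nonneg _ (by exact_mod_cast hn.ne')
    have h1 : c % n < n := Int.emod_lt_of_pos _ (by exact_mod_cast hn)
    omega⟩

/-- `colFin` is `n`-periodic. [folklore] -/
theorem colFin_add {n : ℕ} (hn : 0 < n) (c : ℤ) : colFin hn (c + n) = colFin hn c := by
  apply Fin.ext
  simp [colFin]

/-- The value of `colFin`, as an integer, is `c % n`. [folklore] -/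
theorem colFin_val {n : ℕ} (hn : 0 < n) (c : ℤ) : ((colFin hn c : ℕ) : ℤ) = c % n := by
  simp only [colFin]
  exact Int.toNat_of_nonneg (Int.emod_nonneg _ (by exact_mod_cast hn.ne'))

/-- The successor column: `colFin (c + 1) = (colFin c + 1) mod n`. [folklore] -/
theorem colFin_succ {n : ℕ} (hn : 0 < n) (c : ℤ) :
    colFin hn (c + 1) = ⟨((colFin hn c : ℕ) + 1) % n, Nat.mod_lt _ hn⟩ := by
  apply Fin.ext
  have h1 := colFin_val hn (c + 1)
  have h2 := colFin_val hn c
  apply Int.ofNat.inj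
  simp only [Int.ofNat_eq_natCast]
  push_cast
  rw [h1, h2, Int.add_emod]
  simp

/-- **A torus tiling is a band tiling** on its first `m + 1 ≤ n` rows (read with columns in `ℤ`
modulo `n`). [folklore] -/
theorem IsTorusTiling.isBandTiling {T : WangTileSet ι C} {n : ℕ} (hn : 0 < n)
    {f : Fin n → Fin n → ι} (h : T.IsTorusTiling n f) {m : ℕ} (hm : m < n) :
    T.IsBandTiling n m fun c r => f ⟨r % n, Nat.mod_lt _ hn⟩ (colFin hn c) := by
  refine ⟨fun c r => ?_, fun c r _ => ?_, fun c r hr => ?_⟩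
  · show f _ (colFin hn (c + n)) = f _ (colFin hn c)
    rw [colFin_add]
  · have key := (h ⟨r % n, Nat.mod_lt _ hn⟩ (colFin hn c)).1
    show T.east (f _ (colFin hn c)) = T.west (f _ (colFin hn (c + 1)))
    rw [colFin_succ]
    exact key
  · have hr1 : r + 1 < n := lt_of_le_of_lt (Nat.succ_le_of_lt hr) hm
    have hr0 : r < n := lt_trans hr hm
    have key := (h ⟨r % n, Nat.mod_lt _ hn⟩ (colFin hn c)).2
    show T.south (f ⟨r % n, _⟩ (colFin hn c)) = T.north (f ⟨(r + 1) % n, _⟩ (colFin hn c))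
    convert key using 3
    apply Fin.ext
    simp only
    rw [Nat.mod_eq_of_lt hr0, Nat.mod_eq_of_lt hr1]

end WangTileSet

end Literature.Dynamics.Tilings
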